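import Summits.QuantumAdvantage.QuantumAdvantage.Theorems.LinnikCubicClassGroupsDegreeOnePrimesEscapeSplittingTypeIntervalsAll
import Mathlib.NumberTheory.NumberField.Ideal.KummerDedekind
import HarnessLib

/-!
# Factorisation patterns of an integer polynomial modulo `p` below `(|d_K| · |N f'(θ)|)^{L}`:
# Dedekind–Kummer meets the least prime with a given splitting type

Topic `Summits/QuantumAdvantage/QuantumAdvantage/Theorems`, cell B2b-1 (linnik-cubic), PART A (gen 26);
helper toward the crux `DegreeOnePrimesEscape` (stmt-QuantumAdvantage-11543) of route
`LinnikCubicClassGroups`.  HONEST FRAMING: the value of this file is a THEOREM (kernel-checked, GRH-free,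
unconditional) — NOT summit progress.

Let `θ` be an algebraic integer generating the number field `K = ℚ(θ)` of degree `n`, with minimal
polynomial `f = minpoly ℤ θ ∈ ℤ[X]` (monic irreducible of degree `n`).  Dedekind–Kummer (Mathlib's
`NumberField.Ideal.primesOverSpanEquivMonicFactorsMod`): for a prime `p` not dividing the index
exponent `e_θ = RingOfIntegers.exponent θ` (the least `d > 0` with `d·𝓞_K ⊆ ℤ[θ]`), the primes of `K`
above `p` correspond to the monic irreducible factors of `f mod p`, inertia degree ↦ degree.  Hence:

* `splittingType_eq_map_natDegree_monicFactorsMod` — **the splitting type of `p ∤ e_θ` in `K` is the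
  multiset of degrees of the distinct monic irreducible factors of `f mod p`** (the tree's Perlis
  splitting type `splittingType K p`, in polynomial language);
* `exponent_dvd_absNorm_span_aeval_derivative` — `e_θ ∣ D_θ := |N_{K/ℚ}(f'(θ))|` (`= |disc f|`;
  from Mathlib's `conductor_mul_differentIdeal`: `f'(θ) ∈ 𝔠_θ`), so every `p > D_θ` qualifies;
* `card_roots_toFinset_eq_of_map_natDegree_eq_replicate` — if all these factors are linear and there
  are `n` of them, `f mod p` has exactly `n` distinct roots in `𝔽_p`.
Combined with the tree's Chebotarev–Linnik theorem for splitting types in Bertrand intervals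
(`exists_prime_splittingType_mem_Ioc`, every full cycle type of the Galois group in every `(x, 2x]`,
`x ≥ |d_K|^{L(n)}`), taking `x = max(|d_K|^L, D_θ)` so that the prime found exceeds `D_θ ≥ e_θ`:

* `exists_prime_factorDegrees_eq_cycleType_le` — **for `n > 1` there is `L = L(n)` such that for every
  such `θ` (any `K` of degree `n`), Galois-closure data `(N, ι, ψ)` as in the tree and every
  `σ ∈ Gal(N/ℚ)`, some prime `p ≤ 2·max(|d_K|^L, D_θ)` with `p ∤ d_K`, `p ∤ e_θ` has
  `deg`-multiset of the irreducible factors of `f mod p` equal to the full cycle type of `ψ σ`**;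
* `exists_prime_card_roots_eq_le` — **closure-free special case `σ = 1`: some prime
  `p ≤ 2·max(|d_K|^{L(n)}, D_θ)`, `p ∤ d_K·e_θ`, modulo which `f` has `n` DISTINCT ROOTS** (the least
  prime modulo which an irreducible integer polynomial splits into distinct linear factors is
  polynomially bounded in `|d_K|·|disc f|`, unconditionally; under GRH one has `O((log|d_N|)²)`,
  Lagarias–Odlyzko).
In print the number-field statements are Lagarias–Montgomery–Odlyzko 1979 Thm 1.1 / Weiss 1983; the
polynomial dictionary is Dedekind's theorem (Neukirch, ANT I (8.3)); the combination with an explicit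
dodge of the index divisors is folklore.  0 sorries, standard axioms.
-/

noncomputable section

open scoped NumberField Polynomial
open Polynomial NumberField Ideal UniqueFactorizationMonoid IsDedekindDomain Finset
open Literature.NumberTheory.NumberFields

namespace Summit.QuantumAdvantage.QuantumAdvantage.Theorems.DegreeOnePrimesEscape

/-! ### Dedekind–Kummer in splitting-type language -/

section Dictionary

variable {K : Type*} [Field K] [NumberField K]

/-- **Dedekind–Kummer, splitting-type form**: for `θ ∈ 𝓞_K` and a prime `p ∤ e_θ`
(`RingOfIntegers.exponent θ`), the splitting type of `p` in `K` (multiset of inertia degrees of the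
distinct primes above `p`) is the multiset of degrees of the distinct monic irreducible factors of
`minpoly ℤ θ` modulo `p`. [cite: NeukirchANT1999, Ch. I Prop. (8.3)] -/
theorem splittingType_eq_map_natDegree_monicFactorsMod {θ : 𝓞 K} {p : ℕ} [hp : Fact p.Prime]
    (hθ : ¬ p ∣ RingOfIntegers.exponent θ) :
    splittingType K p = (RingOfIntegers.monicFactorsMod θ p).val.map Polynomial.natDegree := by
  classical
  have hpℤ : (span {(p : ℤ)} : Ideal ℤ) ≠ ⊥ := by
    simp [hp.out.ne_zero]
  set e := NumberField.Ideal.primesOverSpanEquivMonicFactorsMod (K := K) hθ with he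
  have hmapspan : (span {(p : ℤ)} : Ideal ℤ).map (algebraMap ℤ (𝓞 K)) = span {(p : 𝓞 K)} := by
    rw [Ideal.map_span, Set.image_singleton, map_natCast]
  have hmem : ∀ P : Ideal (𝓞 K), P ∈ (normalizedFactors (span {(p : 𝓞 K)})).dedup ↔
      P ∈ (span {(p : ℤ)} : Ideal ℤ).primesOver (𝓞 K) := by
    intro P
    rw [Multiset.mem_dedup, Ideal.mem_primesOver_iff_mem_normalizedFactors _ hpℤ, hmapspan]
  rw [splittingType_def]
  refine Multiset.map_eq_map_of_bij_of_nodup _ _ (Multiset.nodup_dedup _)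
    (RingOfIntegers.monicFactorsMod θ p).nodup
    (fun P hP => ((e ⟨P, (hmem P).1 hP⟩ : RingOfIntegers.monicFactorsMod θ p) : (ZMod p)[X]))
    (fun P hP => (e ⟨P, (hmem P).1 hP⟩).2) (fun P₁ h₁ P₂ h₂ h => ?_) (fun Q hQ => ?_)
    (fun P hP => ?_)
  · have h' : e ⟨P₁, (hmem P₁).1 h₁⟩ = e ⟨P₂, (hmem P₂).1 h₂⟩ := Subtype.ext h
    exact congrArg Subtype.val (e.injective h')
  · refine ⟨((e.symm ⟨Q, hQ⟩ : (span {(p : ℤ)} : Ideal ℤ).primesOver (𝓞 K)) : Ideal (𝓞 K)),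
      (hmem _).2 (e.symm ⟨Q, hQ⟩).2, ?_⟩
    simp
  · have h := NumberField.Ideal.inertiaDeg_primesOverSpanEquivMonicFactorsMod_symm_apply' (K := K) hθ
      (e ⟨P, (hmem P).1 hP⟩).2
    rw [← he] at h
    simpa using h

/-- **The index exponent divides `|N_{K/ℚ}(f'(θ))|`** (`= |disc f|`, `f = minpoly ℤ θ`): for `θ`
generating `K` over `ℚ`, `f'(θ)` lies in the conductor `𝔠_θ` of `ℤ[θ]` (`𝔠_θ · 𝔇_{K/ℚ} = (f'(θ))`,
Mathlib `conductor_mul_differentIdeal`), hence so does the integer `N(f'(θ)𝓞_K) ∈ (f'(θ))`, and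
`e_θ` generates `𝔠_θ ∩ ℤ`. [cite: NeukirchANT1999, Ch. III §2 (2.4)–(2.5)] -/
theorem exponent_dvd_absNorm_span_aeval_derivative {θ : 𝓞 K}
    (hgen : Algebra.adjoin ℚ {(θ : K)} = ⊤) :
    RingOfIntegers.exponent θ ∣ Ideal.absNorm (span {aeval θ (derivative (minpoly ℤ θ))}) := by
  have hcond := conductor_mul_differentIdeal ℤ ℚ K θ hgen
  have hmem : aeval θ (derivative (minpoly ℤ θ)) ∈ conductor ℤ θ := by
    have h1 : aeval θ (derivative (minpoly ℤ θ)) ∈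
        conductor ℤ θ * differentIdeal ℤ (𝓞 K) := by
      rw [hcond]; exact Ideal.mem_span_singleton_self _
    exact Ideal.mul_le_right h1
  set D : ℕ := Ideal.absNorm (span {aeval θ (derivative (minpoly ℤ θ))}) with hD
  have hDmem : ((D : ℤ) : 𝓞 K) ∈ conductor ℤ θ := by
    have h := Ideal.absNorm_mem (span {aeval θ (derivative (minpoly ℤ θ))})
    rw [← hD] at h
    have h' : ((D : ℤ) : 𝓞 K) ∈ span {aeval θ (derivative (minpoly ℤ θ))} := by
      simpa using h
    exact (Ideal.span_singleton_le_iff_mem _).mpr hmem h'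
  have hunder : (D : ℤ) ∈ (conductor ℤ θ).under ℤ := by
    rw [Ideal.under_def, Ideal.mem_comap]
    simpa using hDmem
  have hspan : (conductor ℤ θ).under ℤ = span {((RingOfIntegers.exponent θ : ℕ) : ℤ)} := by
    rw [RingOfIntegers.exponent]; exact (Int.ideal_span_absNorm_eq_self _).symm
  rw [hspan, Ideal.mem_span_singleton] at hunder
  exact Int.natCast_dvd_natCast.mp hunder

/-- **Linear factors and roots**: for a non-zero polynomial `g` over a field, the number of distinct
roots of `g` equals the number of its monic irreducible factors of degree `1` (`a ↦ X − a`).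
[folklore] -/
theorem card_roots_toFinset_eq_card_filter {F : Type*} [Field F] [DecidableEq F] {g : F[X]}
    (hg : g ≠ 0) :
    g.roots.toFinset.card =
      ((normalizedFactors g).toFinset.filter fun Q => Q.natDegree = 1).card := by
  classical
  refine Finset.card_bij (fun a _ => X - C a) (fun a ha => ?_) (fun a₁ _ a₂ _ h => ?_)
    (fun Q hQ => ?_)
  · rw [Multiset.mem_toFinset, mem_roots hg] at ha
    rw [Finset.mem_filter, Multiset.mem_toFinset, Polynomial.mem_normalizedFactors_iff hg]
    exact ⟨⟨irreducible_X_sub_C a, monic_X_sub_C a, dvd_iff_isRoot.mpr ha⟩, natDegree_X_sub_C a⟩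
  · simpa using congrArg (fun P : F[X] => - P.coeff 0) h
  · rw [Finset.mem_filter, Multiset.mem_toFinset, Polynomial.mem_normalizedFactors_iff hg] at hQ
    obtain ⟨⟨-, hmon, hdvd⟩, hdeg⟩ := hQ
    refine ⟨-Q.coeff 0, ?_, ?_⟩
    · rw [Multiset.mem_toFinset, mem_roots hg, ← dvd_iff_isRoot]
      have : X - C (-Q.coeff 0) = Q := by
        rw [map_neg, sub_neg_eq_add]; exact (hmon.eq_X_add_C hdeg).symm
      rwa [this]
    · rw [map_neg, sub_neg_eq_add]; exact (hmon.eq_X_add_C hdeg).symm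

omit [NumberField K] in
/-- **`n` linear factors give `n` distinct roots**: if the degrees of the distinct monic irreducible
factors of `f mod p` (`f = minpoly ℤ θ`) form the multiset `{1, …, 1}` (`n` times), then `f mod p`
has exactly `n` distinct roots in `𝔽_p`. [folklore] -/
theorem card_roots_toFinset_eq_of_map_natDegree_eq_replicate {θ : 𝓞 K} {p n : ℕ} [Fact p.Prime]
    (h : (RingOfIntegers.monicFactorsMod θ p).val.map Polynomial.natDegree = Multiset.replicate n 1) :
    ((minpoly ℤ θ).map (Int.castRingHom (ZMod p))).roots.toFinset.card = n := by
  classical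
  have hg : (minpoly ℤ θ).map (Int.castRingHom (ZMod p)) ≠ 0 :=
    Polynomial.map_monic_ne_zero (minpoly.monic θ.isIntegral)
  rw [card_roots_toFinset_eq_card_filter hg]
  have hall : ∀ Q ∈ RingOfIntegers.monicFactorsMod θ p, Q.natDegree = 1 := by
    intro Q hQ
    have : Q.natDegree ∈ (RingOfIntegers.monicFactorsMod θ p).val.map Polynomial.natDegree :=
      Multiset.mem_map_of_mem _ (Finset.mem_val.mpr hQ)
    rw [h] at this
    exact Multiset.eq_of_mem_replicate this
  have hfilter : ((normalizedFactors ((minpoly ℤ θ).map (Int.castRingHom (ZMod p)))).toFinset.filter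
      fun Q => Q.natDegree = 1) = RingOfIntegers.monicFactorsMod θ p := by
    ext Q
    simp only [Finset.mem_filter, RingOfIntegers.monicFactorsMod, and_iff_left_iff_imp]
    exact fun hQ => hall Q hQ
  rw [hfilter]
  have := congrArg Multiset.card h
  simpa using this

end Dictionary

/-! ### Least primes with prescribed factorisation pattern -/

/-- **Every factorisation pattern below `2·max(|d_K|^L, D_θ)`** (see the module docstring): for `n > 1`
there is `L = L(n) > 0` such that for every number field `K` of degree `n`, Galois-closure data
`(N, ι, ψ)` (`N ⊇ ι(K)` Galois, `[N:ℚ] ≤ n!`, `|d_N| ≤ |d_K|^{[N:ℚ]}`, `ψ : Gal(N/ℚ) → S_n` with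
`Gal(N/ιK) = Stab(0)`; supplied by `exists_galoisClosure_perm`), every `θ ∈ 𝓞_K` and every
`σ ∈ Gal(N/ℚ)`, there is a prime `p ≤ 2·max(|d_K|^L, D_θ)`, `D_θ = N((f'(θ)))`, with `p ∤ d_K`,
`p ∤ e_θ`, such that the degrees of the distinct monic irreducible factors of `minpoly ℤ θ` modulo `p`
form the full cycle type of `ψ σ`.  (For `θ` generating `K`, `e_θ ∣ D_θ` by
`exponent_dvd_absNorm_span_aeval_derivative`; here only `e_θ ≤ D_θ`-by-divisibility is used, via the
hypothesis `hgen`.)  Unconditional. [cite: LagariasMontgomeryOdlyzko1979, Theorem 1.1]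
[cite: NeukirchANT1999, Ch. I Prop. (8.3)] -/
theorem exists_prime_factorDegrees_eq_cycleType_le (n : ℕ) [NeZero n] (hn : 1 < n) :
    ∃ L : ℝ, 0 < L ∧ ∀ (K : Type) [Field K] [NumberField K], Module.finrank ℚ K = n →
      ∀ (N : Type) [Field N] [NumberField N] [IsGalois ℚ N] (ι : K →ₐ[ℚ] N),
        Module.finrank ℚ N ≤ n.factorial →
        (NumberField.discr N).natAbs ≤ (NumberField.discr K).natAbs ^ Module.finrank ℚ N →
        ∀ ψ : (N ≃ₐ[ℚ] N) →* Equiv.Perm (Fin n),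
          (∀ g : N ≃ₐ[ℚ] N, g ∈ ι.fieldRange.fixingSubgroup ↔ ψ g 0 = 0) →
          ∀ θ : 𝓞 K, Algebra.adjoin ℚ {(θ : K)} = ⊤ →
          ∀ σ : N ≃ₐ[ℚ] N, ∃ (p : ℕ) (_ : Fact p.Prime),
            (p : ℝ) ≤ 2 * max (((NumberField.discr K).natAbs : ℝ) ^ L)
              (Ideal.absNorm (span {aeval θ (derivative (minpoly ℤ θ))}) : ℝ) ∧
            ¬ ((p : ℤ) ∣ NumberField.discr K) ∧ ¬ p ∣ RingOfIntegers.exponent θ ∧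
            (RingOfIntegers.monicFactorsMod θ p).val.map Polynomial.natDegree =
              (ψ σ).cycleType + Multiset.replicate (n - (ψ σ).support.card) 1 := by
  obtain ⟨L, hL, h⟩ := exists_prime_splittingType_mem_Ioc n hn
  refine ⟨L, hL, fun K _ _ hK N _ _ _ ι hNle hdN ψ hstab θ hgen σ => ?_⟩
  set D : ℕ := Ideal.absNorm (span {aeval θ (derivative (minpoly ℤ θ))}) with hDdef
  set x : ℝ := max (((NumberField.discr K).natAbs : ℝ) ^ L) (D : ℝ) with hxdef
  obtain ⟨p, hp, hxp, hp2, hnd, hT⟩ := h K hK N ι hNle hdN ψ hstab σ x (le_max_left _ _)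
  haveI : Fact p.Prime := ⟨hp⟩
  -- `p > D ≥ e_θ`, so `p ∤ e_θ`
  have hDx : (D : ℝ) ≤ x := le_max_right _ _
  have hpD : D < p := by exact_mod_cast hDx.trans_lt hxp
  have hdvd : RingOfIntegers.exponent θ ∣ D := exponent_dvd_absNorm_span_aeval_derivative hgen
  have hD0 : D ≠ 0 := by
    rw [hDdef, Ne, Ideal.absNorm_eq_zero_iff, Ideal.span_singleton_eq_bot]
    -- `f'(θ) ≠ 0` by separability
    intro h0
    have hsep : (minpoly ℚ (θ : K)).Separable := Algebra.IsSeparable.isSeparable ℚ (θ : K)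
    have hne := hsep.aeval_derivative_ne_zero (minpoly.aeval ℚ (θ : K))
    apply hne
    rw [show (θ : K) = algebraMap (𝓞 K) K θ from rfl,
      minpoly.isIntegrallyClosed_eq_field_fractions ℚ K θ.isIntegral, derivative_map,
      aeval_map_algebraMap, aeval_algebraMap_apply, h0, map_zero]
  have hexp : ¬ p ∣ RingOfIntegers.exponent θ := by
    intro hpe
    have hle : p ≤ D := (Nat.le_of_dvd (Nat.pos_of_ne_zero ?_) hpe).trans
      (Nat.le_of_dvd (Nat.pos_of_ne_zero hD0) hdvd)
    · omega
    · intro he; rw [he, zero_dvd_iff] at hdvd; exact hD0 hdvd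
  refine ⟨p, inferInstance, ?_, hnd, hexp, ?_⟩
  · calc (p : ℝ) ≤ 2 * x := hp2
      _ = _ := by rw [hxdef]
  · rw [← splittingType_eq_map_natDegree_monicFactorsMod hexp]; exact hT

/-- **The least prime modulo which an irreducible integer polynomial has all its roots** (closure-free
special case `σ = 1`): for `n > 1` there is `L = L(n) > 0` such that for every number field `K` of
degree `n` and every `θ ∈ 𝓞_K` with `K = ℚ(θ)`, there is a prime `p ≤ 2·max(|d_K|^L, D_θ)`,
`D_θ = N((f'(θ))) = |N_{K/ℚ} f'(θ)|` (`f = minpoly ℤ θ`), with `p ∤ d_K`, `p ∤ e_θ`, such that `f` has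
exactly `n = deg f` DISTINCT ROOTS modulo `p` (equivalently: `p` splits completely in `K`).
Unconditional, GRH-free. [cite: LagariasMontgomeryOdlyzko1979, Theorem 1.1 and Corollary 1.3]
[cite: NeukirchANT1999, Ch. I Prop. (8.3)] -/
theorem exists_prime_card_roots_eq_le (n : ℕ) [NeZero n] (hn : 1 < n) :
    ∃ L : ℝ, 0 < L ∧ ∀ (K : Type) [Field K] [NumberField K], Module.finrank ℚ K = n →
      ∀ θ : 𝓞 K, Algebra.adjoin ℚ {(θ : K)} = ⊤ →
        ∃ (p : ℕ) (_ : Fact p.Prime),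
          (p : ℝ) ≤ 2 * max (((NumberField.discr K).natAbs : ℝ) ^ L)
            (Ideal.absNorm (span {aeval θ (derivative (minpoly ℤ θ))}) : ℝ) ∧
          ¬ ((p : ℤ) ∣ NumberField.discr K) ∧ ¬ p ∣ RingOfIntegers.exponent θ ∧
          ((minpoly ℤ θ).map (Int.castRingHom (ZMod p))).roots.toFinset.card = n := by
  obtain ⟨L, hL, h⟩ := exists_prime_factorDegrees_eq_cycleType_le n hn
  refine ⟨L, hL, fun K _ _ hK θ hgen => ?_⟩
  obtain ⟨N, _, _, hGal, hNle, hdN, ι, ψ, hstab⟩ := exists_galoisClosure_perm n K hK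
  haveI := hGal
  obtain ⟨p, hpF, hple, hnd, hexp, hT⟩ := h K hK N ι hNle hdN ψ hstab θ hgen 1
  refine ⟨p, hpF, hple, hnd, hexp, card_roots_toFinset_eq_of_map_natDegree_eq_replicate ?_⟩
  rw [hT, map_one, Equiv.Perm.cycleType_one, Equiv.Perm.support_one, Finset.card_empty,
    Nat.sub_zero, zero_add]

end Summit.QuantumAdvantage.QuantumAdvantage.Theorems.DegreeOnePrimesEscape

end
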